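import Summits.BirchSwinnertonDyer.BirchSwinnertonDyer.Theorems.QuadraticBranchSignedControlPlusEtaNonsurjOfCMCongruentTransfer
import Summits.BirchSwinnertonDyer.BirchSwinnertonDyer.Theorems.QuadraticBranchSignedControlPlusEtaNonsurjCartanRows
import Summits.BirchSwinnertonDyer.BirchSwinnertonDyer.Theorems.QuadraticBranchSignedControlPlusEtaNonsurjCMAnchorInert
import HarnessLib

/-!
# Route `QuadraticBranchSignedControl` (rung K8, cell `bsd-potss`): crux stmt-BirchSwinnertonDyer-19606
# `PlusEtaMainConjectureNonsurj` — THE ROWS AT THE BDMTV PRIMES `p = 13` AND `p = 17`: EXACTLY SEVEN CM `j`-CLASSES EACH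
# (the moduli COUNT `#X_ns⁺(13)(ℚ) = #X_ns⁺(17)(ℚ) = 7` in the kernel, modulo the two published CM-ness theorems), and the crux
# there needs ONLY the CM inputs of skeleton v7 (no transfer binder, no uncongruent stub)

WHAT. The rows of crux 19606 (`V/ℚ` globally minimal, `p ≥ 5` good, `a_p(V) = 0`, `p`-adic tower NOT onto) are exactly the
non-cuspidal `ℚ`-points of `X_ns⁺(p)` (k8eta-c2 g0, `not_forall_surj_pow_iff_cartanNormalizer`). At `p = 13` and `p = 17` the
published theorems of Balakrishnan–Dogra–Müller–Tuitman–Vonk (Ann. of Math. 2019, Cor. 1.3; Compositio 2023, Thm. 1.2 — the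
tree's named facts `BDMTV2019_nonsplitCartan_level13`, `BDMTV2023_nonsplitCartan_level17`, vendored in the moduli form «every
`E/ℚ` with mod-`p` image in `C_ns⁺(p)` has CM», the COUNT `7` left as `-- TODO(general form)` in
`Literature/NumberTheory/SerreUniformity/Statement.lean`) make every row CM (g0, `nonCMCartanRows_off_13_17`). This file adds:

* §1 (kernel, no BDMTV) `j_mem_seven_of_hasCM_of_cmInert_thirteen` / `_seventeen`: a CM curve over `ℚ` with `13` (resp. `17`)
  INERT in its CM field has `j ∈ {−3375, 16581375, 8000, −32768, −884736, −147197952000, −262537412640768000}` (discriminants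
  `−7, −28, −8, −11, −19, −67, −163`) resp. `j ∈ {0, 54000, −12288000, −3375, 16581375, −32768, −262537412640768000}`
  (`−3, −12, −27, −7, −28, −11, −163`): the tree's THEOREM `hasCM_iff_j_mem_holds` (13 CM `j`'s), the table `cmFieldDiscrOfJ`, and the
  six resp. six class-number-one discriminants that are squares mod `13` (`−3 ≡ 6²`, `−4 ≡ 3²`, `−43 ≡ 3²`) resp. mod `17`
  (`−4 ≡ 8²`, `−8 ≡ 3²`, `−19 ≡ 7²`, `−43 ≡ 5²`, `−67 ≡ 1²`).
* §2 `j_mem_seven_of_row_thirteen` / `_seventeen`: GIVEN the BDMTV fact (hypothesis position), every row of the crux at `p = 13`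
  (resp. `17`) has `j` in that seven-element set — CM by BDMTV ∘ g0, `p` inert by k8eta-c2 g14's `cmInert_of_cmAnchor` (Deuring, both
  halves, by name: a CM curve good at `p ≥ 5` with `a_p = 0` has `p` inert).
* (sibling file `…PlusEtaNonsurjBDMTVPrimesRows`, kernel, no BDMTV: conversely EACH of the seven `j` occurs on a row — reference
  curves `49a1, 49a3, [0,4,0,2,0], 121b1, 361a1, 4489a1, 26569a1` resp. `27a3, 36a2, 27a4, 49a1, 49a3, 121b1, 26569a1`, globally minimal,
  good at `p` with `#E(𝔽_p) = p + 1`, CM, tower not onto (Zywina) — so that, with §2, the `j`-set of the rows at `13` resp. `17` IS the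
  seven-element set: the moduli form of `#X_ns⁺(13)(ℚ) = #X_ns⁺(17)(ℚ) = 7`, the count being kernel arithmetic once CM-ness is granted.)
* §3 the crux at the BDMTV primes: `quadraticBranchPlusEtaMainConjectureAt_of_cmInputs_of_eq_13_or_17` — at a row with
  `p ∈ {13, 17}` the node (C1⁺_η)(V,p) follows from the CM inputs of skeleton v7 ALONE (Kobayashi Thm 2.2η / 6.2–7.3η `h22 h6273`,
  Burungale–Tian Thm 2.6 `h26`, (A) on the CM partners `hAcm`, analytic `μ = 0` on the CM rows `hμcm`; k8eta-c2 g7's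
  `EtaFineRoad.etaMC_cm_of_bt26_of_conjA_partners_of_analyticMu`) plus the BDMTV fact — NO Corpuz–Lei transfer binder and NO
  `stub_etaMC_nonCM_uncongruent`; and `plusEtaMainConjectureNonsurj_of_cmConjA_of_transfer_of_uncongruent_off_13_17` — the v7
  composition (k8eta-c2 g8 `EtaCMCongruentTransfer.…`) with the hardest stub's text RESTRICTED to `p ≠ 13 ∧ p ≠ 17` (class-wide, by
  citation). Docstring material for the planner's R203 bundle: the domain of `stub_etaMC_nonCM_uncongruent` may carry `p ∉ {13, 17}`
  (and, under the OPEN `SerreUniformityBound 37`, `p ≤ 37` — g0 `nonCMCartanRows_le_37_of_serreUniformityBound`).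

HONEST FRAMING (cell `bsd-potss`, run/shared/lean/pub/bsd-potss/; FULL-BSD rank ≤ 1 programme): TOOL / BOOKKEEPING THEOREMS; no
definition, no new named fact, no `sorry`, axioms standard. §1 unconditional; §2/§3 conditional on the displayed published facts (BDMTV
2019/2023, already typed in the tree) and §3 on the displayed v7 inputs. The CM rows at `13`/`17`
are still infinitely many curves (all quadratic twists, `p ∤ d`, of the seven), each with its own (A) and analytic-`μ` input: nothing is
closed; crux 19606 stays OPEN; `BSD(W, p)` is claimed for no pair. Seat `bsd-potss-k8eta-c2` g17 (prover), `--supports stmt-BirchSwinnertonDyer-19606`.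

References: [BalakrishnanEtAl2019] Cor. 1.3 (`X_ns⁺(13)(ℚ)`: 7 CM points, discriminants −7, −8, −11, −19, −28, −67, −163);
[BalakrishnanEtAl2023] Thm. 1.2 (`X_ns⁺(17)(ℚ)`: 7 CM points, discriminants −3, −7, −11, −12, −27, −28, −163); [Serre1972] §1.11 Prop. 12,
§2.7 Prop. 17, §4.5; [Lang1987] Ch. 13 §4 Thm. 12 (Deuring); [Cox2013] Prop. 5.16 / Cor. 5.17; [SilvermanAdvancedTopics1994] App. A §3
(13 CM `j`-invariants); [Zywina2015] Prop. 1.14; [Cremona1997] Table 1 (27a3, 27a4, 36a2, 49a1, 49a3, 121b1, 361a1, 4489a1, 26569a1);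
[Kobayashi2003] §4 Even main conjecture (p. 8); [BurungaleTian2026] Thm. 2.6; [CorpuzLei2025] Thms 1–3 (claim, NOT used at 13/17).
-/

set_option autoImplicit false
set_option linter.dupNamespace false

noncomputable section

open scoped Classical

open CongruenceSubgroup Field WeierstrassCurve Literature.NumberTheory.EllipticCurves
  Literature.NumberTheory.EllipticCurves.ModularForms Literature.NumberTheory.GaloisRepresentations
  Literature.NumberTheory.EllipticCurves.Rank1Residual Literature.NumberTheory.EllipticCurves.Rank1Residual.Typed
  Literature.NumberTheory.EllipticCurves.GreenbergVatsal2000 Literature.NumberTheory.SerreUniformity ZpExtension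
  Summit.BirchSwinnertonDyer.Rank1Residual.Additive
  Summit.BirchSwinnertonDyer.BirchSwinnertonDyer.Theses.QuadraticBranchSignedControl
open Summit.BirchSwinnertonDyer.Rank1Residual.O6 (ModPCongruent)

namespace Summit.BirchSwinnertonDyer.BirchSwinnertonDyer.Theorems.EtaBDMTVPrimes

open Summit.BirchSwinnertonDyer.BirchSwinnertonDyer.Theorems.EtaCartanField

/-! ## §1 CM curves with `13` resp. `17` inert: the seven `j`-invariants (kernel) -/

/-- **A CM curve over `ℚ` with `13` INERT in its CM field has `j ∈ {−3375, 16581375, 8000, −32768, −884736, −147197952000,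
−262537412640768000}`** (the class-number-one orders of discriminant `−7, −28, −8, −11, −19, −67, −163`; the other six CM `j`'s have
`d_K ∈ {−3, −4, −43}`, squares mod `13`: `−3 ≡ 6²`, `−4 ≡ 3²`, `−43 ≡ 3²`). Kernel: `hasCM_iff_j_mem_holds` + the table `cmFieldDiscrOfJ`.
[cite: SilvermanAdvancedTopics1994, App. A §3] [cite: Cox2013, Prop. 5.16 and Cor. 5.17] -/
theorem j_mem_seven_of_hasCM_of_cmInert_thirteen (A : WeierstrassCurve ℚ) [A.IsElliptic] (hCM : A.HasCM) (h : CMInert A 13) :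
    A.j ∈ ({-3375, 16581375, 8000, -32768, -884736, -147197952000, -262537412640768000} : Finset ℚ) := by
  obtain ⟨-, hns⟩ := h
  unfold CMSplit at hns
  have hj := (hasCM_iff_j_mem_holds A).mp hCM
  simp only [cmJInvariants, Finset.mem_insert, Finset.mem_singleton] at hj ⊢
  rcases hj with h | h | h | h | h | h | h | h | h | h | h | h | h
  · -- `j = 0`, `d = −3`: `13` splits
    have hd : cmFieldDiscrOfJ A.j = -3 := by rw [h]; norm_num [cmFieldDiscrOfJ]
    exact absurd ⟨by rw [hd]; decide, by rw [if_neg (by decide), hd]; exact ⟨6, by decide⟩⟩ hns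
  · -- `j = 1728`, `d = −4`
    have hd : cmFieldDiscrOfJ A.j = -4 := by rw [h]; norm_num [cmFieldDiscrOfJ]
    exact absurd ⟨by rw [hd]; decide, by rw [if_neg (by decide), hd]; exact ⟨3, by decide⟩⟩ hns
  · exact Or.inl h
  · exact Or.inr (Or.inr (Or.inl h))
  · exact Or.inr (Or.inr (Or.inr (Or.inl h)))
  · -- `j = 54000`, `d = −3`
    have hd : cmFieldDiscrOfJ A.j = -3 := by rw [h]; norm_num [cmFieldDiscrOfJ]
    exact absurd ⟨by rw [hd]; decide, by rw [if_neg (by decide), hd]; exact ⟨6, by decide⟩⟩ hns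
  · -- `j = 287496`, `d = −4`
    have hd : cmFieldDiscrOfJ A.j = -4 := by rw [h]; norm_num [cmFieldDiscrOfJ]
    exact absurd ⟨by rw [hd]; decide, by rw [if_neg (by decide), hd]; exact ⟨3, by decide⟩⟩ hns
  · exact Or.inr (Or.inr (Or.inr (Or.inr (Or.inl h))))
  · -- `j = −12288000`, `d = −3`
    have hd : cmFieldDiscrOfJ A.j = -3 := by rw [h]; norm_num [cmFieldDiscrOfJ]
    exact absurd ⟨by rw [hd]; decide, by rw [if_neg (by decide), hd]; exact ⟨6, by decide⟩⟩ hns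
  · exact Or.inr (Or.inl h)
  · -- `j = −884736000`, `d = −43 ≡ 9 = 3²`
    have hd : cmFieldDiscrOfJ A.j = -43 := by rw [h]; norm_num [cmFieldDiscrOfJ]
    exact absurd ⟨by rw [hd]; decide, by rw [if_neg (by decide), hd]; exact ⟨3, by decide⟩⟩ hns
  · exact Or.inr (Or.inr (Or.inr (Or.inr (Or.inr (Or.inl h)))))
  · exact Or.inr (Or.inr (Or.inr (Or.inr (Or.inr (Or.inr h)))))

/-- **A CM curve over `ℚ` with `17` INERT in its CM field has `j ∈ {0, 54000, −12288000, −3375, 16581375, −32768,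
−262537412640768000}`** (discriminants `−3, −12, −27, −7, −28, −11, −163`; the other six CM `j`'s have `d_K ∈ {−4, −8, −19, −43, −67}`,
squares mod `17`: `−4 ≡ 8²`, `−8 ≡ 3²`, `−19 ≡ 7²`, `−43 ≡ 5²`, `−67 ≡ 1²`). [cite: SilvermanAdvancedTopics1994, App. A §3]
[cite: Cox2013, Prop. 5.16 and Cor. 5.17] -/
theorem j_mem_seven_of_hasCM_of_cmInert_seventeen (A : WeierstrassCurve ℚ) [A.IsElliptic] (hCM : A.HasCM) (h : CMInert A 17) :
    A.j ∈ ({0, 54000, -12288000, -3375, 16581375, -32768, -262537412640768000} : Finset ℚ) := by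
  obtain ⟨-, hns⟩ := h
  unfold CMSplit at hns
  have hj := (hasCM_iff_j_mem_holds A).mp hCM
  simp only [cmJInvariants, Finset.mem_insert, Finset.mem_singleton] at hj ⊢
  rcases hj with h | h | h | h | h | h | h | h | h | h | h | h | h
  · exact Or.inl h
  · -- `j = 1728`, `d = −4 ≡ 13 = 8²`
    have hd : cmFieldDiscrOfJ A.j = -4 := by rw [h]; norm_num [cmFieldDiscrOfJ]
    exact absurd ⟨by rw [hd]; decide, by rw [if_neg (by decide), hd]; exact ⟨8, by decide⟩⟩ hns
  · exact Or.inr (Or.inr (Or.inr (Or.inl h)))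
  · -- `j = 8000`, `d = −8 ≡ 9 = 3²`
    have hd : cmFieldDiscrOfJ A.j = -8 := by rw [h]; norm_num [cmFieldDiscrOfJ]
    exact absurd ⟨by rw [hd]; decide, by rw [if_neg (by decide), hd]; exact ⟨3, by decide⟩⟩ hns
  · exact Or.inr (Or.inr (Or.inr (Or.inr (Or.inr (Or.inl h)))))
  · exact Or.inr (Or.inl h)
  · -- `j = 287496`, `d = −4`
    have hd : cmFieldDiscrOfJ A.j = -4 := by rw [h]; norm_num [cmFieldDiscrOfJ]
    exact absurd ⟨by rw [hd]; decide, by rw [if_neg (by decide), hd]; exact ⟨8, by decide⟩⟩ hns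
  · -- `j = −884736`, `d = −19 ≡ 15 = 7²`
    have hd : cmFieldDiscrOfJ A.j = -19 := by rw [h]; norm_num [cmFieldDiscrOfJ]
    exact absurd ⟨by rw [hd]; decide, by rw [if_neg (by decide), hd]; exact ⟨7, by decide⟩⟩ hns
  · exact Or.inr (Or.inr (Or.inl h))
  · exact Or.inr (Or.inr (Or.inr (Or.inr (Or.inl h))))
  · -- `j = −884736000`, `d = −43 ≡ 8 = 5²`
    have hd : cmFieldDiscrOfJ A.j = -43 := by rw [h]; norm_num [cmFieldDiscrOfJ]
    exact absurd ⟨by rw [hd]; decide, by rw [if_neg (by decide), hd]; exact ⟨5, by decide⟩⟩ hns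
  · -- `j = −147197952000`, `d = −67 ≡ 1`
    have hd : cmFieldDiscrOfJ A.j = -67 := by rw [h]; norm_num [cmFieldDiscrOfJ]
    exact absurd ⟨by rw [hd]; decide, by rw [if_neg (by decide), hd]; exact ⟨1, by decide⟩⟩ hns
  · exact Or.inr (Or.inr (Or.inr (Or.inr (Or.inr (Or.inr h)))))

/-! ## §2 The rows of crux 19606 at `p = 13`, `17`: seven `j`-classes (given BDMTV) -/

/-- **A row of crux 19606 at `p = 13` or `17` is CM** (k8eta-c2 g0's `nonCMCartanRows_off_13_17` at row level): its mod-`p` image is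
exactly `C_ns⁺(p)` (`not_forall_surj_pow_iff_cartanNormalizer`), and `X_ns⁺(13)(ℚ)`, `X_ns⁺(17)(ℚ)` are CM (BDMTV, named facts in
hypothesis position). [cite: BalakrishnanEtAl2019, Cor. 1.3] [cite: BalakrishnanEtAl2023, Thm. 1.2] [cite: Serre1972, §1.11 Prop. 12, §2.7 Prop. 17] -/
theorem hasCM_of_row_of_eq_13_or_17 (h13 : BDMTV2019_nonsplitCartan_level13) (h17 : BDMTV2023_nonsplitCartan_level17)
    (V : WeierstrassCurve ℚ) [V.IsElliptic] [V.IsGloballyMinimal] (p : ℕ) [Fact p.Prime] (hp : p = 13 ∨ p = 17)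
    (hgood : V.HasGoodReductionAtPrime p) (hap : V.frobeniusTrace p = 0)
    (hns : ¬ ∀ m : ℕ, V.HasSurjectiveModNGaloisRep (p ^ m : ℕ)) : V.HasCM := by
  have hC := (not_forall_surj_pow_iff_cartanNormalizer V p (by omega) hgood hap).mp hns
  rcases hp with rfl | rfl
  · exact h13 V hC.hasNonsplitCartanModPImage
  · exact h17 V hC.hasNonsplitCartanModPImage

/-- **Rows at `p = 13`: seven `j`-classes.** GIVEN BDMTV 2019 Cor. 1.3 (`X_ns⁺(13)(ℚ)` is CM; named fact, hypothesis position): every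
row of crux 19606 at `p = 13` — `V/ℚ` globally minimal, good at `13`, `a_13(V) = 0`, `13`-adic tower not onto — has
`j(V) ∈ {−3375, 16581375, 8000, −32768, −884736, −147197952000, −262537412640768000}` (the seven CM points of `X_ns⁺(13)`,
discriminants `−7, −28, −8, −11, −19, −67, −163`). CM by BDMTV, `13` inert by Deuring (`cmInert_of_cmAnchor`), §1.
[cite: BalakrishnanEtAl2019, Cor. 1.3] [cite: Lang1987, Ch. 13 §4 Thm. 12] [cite: SilvermanAdvancedTopics1994, App. A §3] -/
theorem j_mem_seven_of_row_thirteen (h13 : BDMTV2019_nonsplitCartan_level13) (V : WeierstrassCurve ℚ) [V.IsElliptic]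
    [V.IsGloballyMinimal] (p : ℕ) [Fact p.Prime] (hp : p = 13) (hgood : V.HasGoodReductionAtPrime p)
    (hap : V.frobeniusTrace p = 0) (hns : ¬ ∀ m : ℕ, V.HasSurjectiveModNGaloisRep (p ^ m : ℕ)) :
    V.j ∈ ({-3375, 16581375, 8000, -32768, -884736, -147197952000, -262537412640768000} : Finset ℚ) := by
  subst hp
  have hC := (not_forall_surj_pow_iff_cartanNormalizer V 13 (by norm_num) hgood hap).mp hns
  have hCM : V.HasCM := h13 V hC.hasNonsplitCartanModPImage
  exact j_mem_seven_of_hasCM_of_cmInert_thirteen V hCM (cmInert_of_cmAnchor V 13 (by norm_num) hCM hgood hap)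

/-- **Rows at `p = 17`: seven `j`-classes.** GIVEN BDMTV 2023 Thm. 1.2 (`X_ns⁺(17)(ℚ)` is CM; named fact, hypothesis position): every
row of crux 19606 at `p = 17` has `j(V) ∈ {0, 54000, −12288000, −3375, 16581375, −32768, −262537412640768000}` (the seven CM points of
`X_ns⁺(17)`, discriminants `−3, −12, −27, −7, −28, −11, −163`). [cite: BalakrishnanEtAl2023, Thm. 1.2] [cite: Lang1987, Ch. 13 §4 Thm. 12]
[cite: SilvermanAdvancedTopics1994, App. A §3] -/
theorem j_mem_seven_of_row_seventeen (h17 : BDMTV2023_nonsplitCartan_level17) (V : WeierstrassCurve ℚ) [V.IsElliptic]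
    [V.IsGloballyMinimal] (p : ℕ) [Fact p.Prime] (hp : p = 17) (hgood : V.HasGoodReductionAtPrime p)
    (hap : V.frobeniusTrace p = 0) (hns : ¬ ∀ m : ℕ, V.HasSurjectiveModNGaloisRep (p ^ m : ℕ)) :
    V.j ∈ ({0, 54000, -12288000, -3375, 16581375, -32768, -262537412640768000} : Finset ℚ) := by
  subst hp
  have hC := (not_forall_surj_pow_iff_cartanNormalizer V 17 (by norm_num) hgood hap).mp hns
  have hCM : V.HasCM := h17 V hC.hasNonsplitCartanModPImage
  exact j_mem_seven_of_hasCM_of_cmInert_seventeen V hCM (cmInert_of_cmAnchor V 17 (by norm_num) hCM hgood hap)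

/-! ## §3 The crux at the BDMTV primes needs only the CM inputs of skeleton v7 -/

/-- **At a row with `p ∈ {13, 17}` the node (C1⁺_η)(V,p) follows from the CM inputs of skeleton v7 alone** — Kobayashi Thm 2.2η
(`h22`), Thm 6.2/6.3/7.3η (`h6273`), Burungale–Tian Thm 2.6 (`h26`), (A) on the additive partners of the CM twists (`hAcm`, the text of
`stub_conjA_partners_cm`), the analytic `μ = 0` on the CM rows (`hμcm`, the text of `stub_analyticEtaMu_cm`) — plus the BDMTV facts:
NO Corpuz–Lei transfer binder and NO `stub_etaMC_nonCM_uncongruent`. CM branch = k8eta-c2 g7's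
`EtaFineRoad.etaMC_cm_of_bt26_of_conjA_partners_of_analyticMu`. CONDITIONAL; nothing booked; the crux stays open.
[cite: BalakrishnanEtAl2019, Cor. 1.3] [cite: BalakrishnanEtAl2023, Thm. 1.2] [cite: BurungaleTian2026, Thm. 2.6]
[cite: Kobayashi2003, Thm. 2.2 (p. 5), §4 (p. 8), Thm. 7.3 i) and Cor. 7.2] [cite: CoatesSujatha2005, §3 statement (A) and Thm. 3.4] -/
theorem quadraticBranchPlusEtaMainConjectureAt_of_cmInputs_of_eq_13_or_17
    (h13 : BDMTV2019_nonsplitCartan_level13) (h17 : BDMTV2023_nonsplitCartan_level17)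
    (h22 : Kobayashi2003.thm22_etaSignedSelmerDual_finite_torsion)
    (h6273 : Kobayashi2003.thm62_63_73_etaColemanPoitouTate)
    (h26 : BurungaleTian2026.thm26_etaKatoSequences_charIdeal_upToP_of_cm)
    (hAcm : ∀ (V : WeierstrassCurve ℚ) [V.IsElliptic] [V.IsGloballyMinimal] (W : WeierstrassCurve ℚ) [W.IsElliptic]
      [W.IsGloballyMinimal] (C : VariableChange ℚ) (p : ℕ) [Fact p.Prime],
      5 ≤ p → C • W.quadraticTwist ((-1) ^ (p / 2) * p) = V →
      V.HasGoodReductionAtPrime p → V.frobeniusTrace p = 0 →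
      ¬ (∀ m : ℕ, V.HasSurjectiveModNGaloisRep (p ^ m : ℕ)) → V.HasCM →
      ∀ (κ : ZpExtension ℚ p), κ.IsCyclotomic →
        ∃ (γ : absoluteGaloisGroup ℚ) (D : W.FineSelmerDualData κ γ),
          Module.Finite ℤ_[p] (RestrictScalars ℤ_[p] (IwasawaAlgebra p) D.X))
    (hμcm : ∀ (V : WeierstrassCurve ℚ) [V.IsElliptic] [V.IsGloballyMinimal] (p : ℕ) [Fact p.Prime],
      5 ≤ p → V.HasGoodReductionAtPrime p → V.frobeniusTrace p = 0 →
      ¬ (∀ m : ℕ, V.HasSurjectiveModNGaloisRep (p ^ m : ℕ)) → V.HasCM →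
      ∀ {N : ℕ} [NeZero N] {f : CuspForm (Gamma0 N) 2}, IsNewformOf V f →
        ∀ (ϖ : ℚ), (if Even (p / 2) then (ϖ : ℝ) * V.realPeriodRat = plusPeriod f
            else (ϖ : ℝ) * V.imaginaryPeriodRat = minusPeriod f) →
        ∀ (Lη : IwasawaAlgebra p), IsQuadraticBranchPlusLFunction f p ϖ Lη → HasUnitContent Lη)
    (V : WeierstrassCurve ℚ) [V.IsElliptic] [V.IsGloballyMinimal] (p : ℕ) [Fact p.Prime] (hp : p = 13 ∨ p = 17)
    (hgood : V.HasGoodReductionAtPrime p) (hap : V.frobeniusTrace p = 0)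
    (hns : ¬ ∀ m : ℕ, V.HasSurjectiveModNGaloisRep (p ^ m : ℕ)) :
    QuadraticBranchPlusEtaMainConjectureAt V p :=
  EtaFineRoad.etaMC_cm_of_bt26_of_conjA_partners_of_analyticMu h26 h22 h6273 hAcm hμcm V p (by omega) hgood hap hns
    (hasCM_of_row_of_eq_13_or_17 h13 h17 V p hp hgood hap hns)

/-- **The crux `PlusEtaMainConjectureNonsurj` BY NAME with the hardest stub OFF the BDMTV primes.** The v7 composition of k8eta-c2 g8
(`EtaCMCongruentTransfer.plusEtaMainConjectureNonsurj_of_cmConjA_of_transfer_of_uncongruent`: CM rows from (A) + analytic `μ` mod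
Burungale–Tian/Kobayashi; non-CM rows congruent to a CM row via the OPEN Corpuz–Lei binder; the rest from the stub), with the text of
`stub_etaMC_nonCM_uncongruent` required ONLY for `p ≠ 13 ∧ p ≠ 17` — at `13` and `17` there are no non-CM rows (BDMTV, named facts in
hypothesis position). CONDITIONAL on the displayed inputs; closes nothing by itself; nothing booked.
[cite: BalakrishnanEtAl2019, Cor. 1.3] [cite: BalakrishnanEtAl2023, Thm. 1.2] [claim: CorpuzLei2025, status: under-review]
[cite: BurungaleTian2026, Thm. 2.6] [cite: Kobayashi2003, Thm. 2.2 (p. 5), §4 (p. 8), Thm. 7.3 i) and Cor. 7.2]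
[cite: CoatesSujatha2005, §3 statement (A) and Thm. 3.4] [cite: GreenbergVatsal2000, Thm. (1.4)] -/
theorem plusEtaMainConjectureNonsurj_of_cmConjA_of_transfer_of_uncongruent_off_13_17
    (h13 : BDMTV2019_nonsplitCartan_level13) (h17 : BDMTV2023_nonsplitCartan_level17)
    (h22 : Kobayashi2003.thm22_etaSignedSelmerDual_finite_torsion)
    (h6273 : Kobayashi2003.thm62_63_73_etaColemanPoitouTate)
    (h26 : BurungaleTian2026.thm26_etaKatoSequences_charIdeal_upToP_of_cm)
    (hCL : CorpuzLei2025_etaPlusMainConjecture_transfer_anMu_OPEN)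
    (hAcm : ∀ (V : WeierstrassCurve ℚ) [V.IsElliptic] [V.IsGloballyMinimal] (W : WeierstrassCurve ℚ) [W.IsElliptic]
      [W.IsGloballyMinimal] (C : VariableChange ℚ) (p : ℕ) [Fact p.Prime],
      5 ≤ p → C • W.quadraticTwist ((-1) ^ (p / 2) * p) = V →
      V.HasGoodReductionAtPrime p → V.frobeniusTrace p = 0 →
      ¬ (∀ m : ℕ, V.HasSurjectiveModNGaloisRep (p ^ m : ℕ)) → V.HasCM →
      ∀ (κ : ZpExtension ℚ p), κ.IsCyclotomic →
        ∃ (γ : absoluteGaloisGroup ℚ) (D : W.FineSelmerDualData κ γ),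
          Module.Finite ℤ_[p] (RestrictScalars ℤ_[p] (IwasawaAlgebra p) D.X))
    (hμcm : ∀ (V : WeierstrassCurve ℚ) [V.IsElliptic] [V.IsGloballyMinimal] (p : ℕ) [Fact p.Prime],
      5 ≤ p → V.HasGoodReductionAtPrime p → V.frobeniusTrace p = 0 →
      ¬ (∀ m : ℕ, V.HasSurjectiveModNGaloisRep (p ^ m : ℕ)) → V.HasCM →
      ∀ {N : ℕ} [NeZero N] {f : CuspForm (Gamma0 N) 2}, IsNewformOf V f →
        ∀ (ϖ : ℚ), (if Even (p / 2) then (ϖ : ℝ) * V.realPeriodRat = plusPeriod f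
            else (ϖ : ℝ) * V.imaginaryPeriodRat = minusPeriod f) →
        ∀ (Lη : IwasawaAlgebra p), IsQuadraticBranchPlusLFunction f p ϖ Lη → HasUnitContent Lη)
    (huncong : ∀ (V : WeierstrassCurve ℚ) [V.IsElliptic] [V.IsGloballyMinimal] (p : ℕ) [Fact p.Prime],
      5 ≤ p → p ≠ 13 → p ≠ 17 → V.HasGoodReductionAtPrime p → V.frobeniusTrace p = 0 →
      ¬ (∀ m : ℕ, V.HasSurjectiveModNGaloisRep (p ^ m : ℕ)) → ¬ V.HasCM →
      ¬ (∃ (V'' : WeierstrassCurve ℚ) (_ : V''.IsElliptic) (_ : V''.IsGloballyMinimal),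
          V''.HasCM ∧ V''.HasGoodReductionAtPrime p ∧ V''.frobeniusTrace p = 0 ∧ ModPCongruent V'' V p) →
      QuadraticBranchPlusEtaMainConjectureAt V p) :
    PlusEtaMainConjectureNonsurj := by
  refine EtaCMCongruentTransfer.plusEtaMainConjectureNonsurj_of_cmConjA_of_transfer_of_uncongruent h22 h6273 h26 hCL hAcm hμcm ?_
  intro V _ _ p _ hp5 hgood hap hns hncm hcg
  by_cases hp : p = 13 ∨ p = 17
  · exact absurd (hasCM_of_row_of_eq_13_or_17 h13 h17 V p hp hgood hap hns) hncm
  · obtain ⟨hp13, hp17⟩ := not_or.mp hp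
    exact huncong V p hp5 hp13 hp17 hgood hap hns hncm hcg

end Summit.BirchSwinnertonDyer.BirchSwinnertonDyer.Theorems.EtaBDMTVPrimes

end
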